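import Summits.Ventures.HodgeRepro.FaceCensusEngine
import Summits.Ventures.HodgeRepro.EngineMasks

/-!
# EngineFacesWF — generic facts about the face-census engine, part 2 (seat p4, blind cell pub-hodge-repro)

For an ARBITRARY Cayley table `Γ` with the group axioms (`Γ.isCMGaloisType = true`, unpacked by the `IsGroupTable.*` theorems of `EngineMasks`):
EVERY face `(Φ; π, π′)` of `Γ.faces` satisfies `sumTwo` (every embedding lies in exactly two corners —
Milne 2020 §2.2: the corner product is of split Weil type), `cornersWF` for `n ≥ 3` (four distinct
CM-type corners) and `noConjugateCorners` for `n ≥ 5` (no corner is the conjugate of another).  These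
are the structural reasons behind the census rows; they replace 1920-face kernel computations by proofs.
-/

namespace Summit.Ventures.HodgeRepro.FaceCensus

namespace CMGaloisType

variable {n : ℕ} (Γ : CMGaloisType n)

/-! ### Every face has the `SumTwo` property -/

/-- Bits of the four corners of the face `(T, placeMask a, placeMask b)` at `i`, in terms of
`t = mem i T`, `mp = mem i (placeMask a)`, `mq = mem i (placeMask b)`. -/
theorem mem_corners (hΓ : Γ.isCMGaloisType = true) {T : ℕ} (hT : Γ.isCMType T = true) (p q : ℕ) (i : Fin n) :
    (Γ.corners (T, p, q)).map (mem i) =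
      [mem i T, (!mem i T) ^^ mem i p, (!mem i T) ^^ mem i q, (mem i T ^^ mem i p) ^^ mem i q] := by
  simp [corners, mem_flipAt, Γ.mem_bar_of_isCMType hΓ hT]

/-- **Every face satisfies `SumTwo`**: for a face `(T; p, q)` of any Cayley table with the group axioms, every embedding `i` lies in exactly two of the four corners (the two places are disjoint, and the remaining three bit patterns each give exactly two). -/
theorem sumTwo_of_mem_faces (hΓ : Γ.isCMGaloisType = true) {f : ℕ × ℕ × ℕ} (hf : f ∈ Γ.faces) :
    Γ.sumTwo f = true := by
  obtain ⟨T, p, q⟩ := f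
  rw [Γ.mem_faces] at hf
  obtain ⟨hT, hp, hq, hqp⟩ := hf
  rw [Γ.mem_cmTypes] at hT
  obtain ⟨a, rfl⟩ := (Γ.mem_places p).1 hp
  obtain ⟨b, rfl⟩ := (Γ.mem_places q).1 hq
  simp only [sumTwo, List.all_eq_true, List.mem_finRange, true_imp_iff, beq_iff_eq]
  intro i
  have key := Γ.mem_corners hΓ hT (Γ.placeMask a) (Γ.placeMask b) i
  have hlen : ((Γ.corners (T, Γ.placeMask a, Γ.placeMask b)).filter fun S => mem i S).length =
      (((Γ.corners (T, Γ.placeMask a, Γ.placeMask b)).map (mem i)).filter id).length := by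
    rw [List.filter_map]; simp
  rw [hlen, key]
  have hnot : ¬ (mem i (Γ.placeMask a) = true ∧ mem i (Γ.placeMask b) = true) :=
    fun h => Γ.not_mem_both_places hΓ (Ne.symm hqp) h.1 h.2
  cases mem i T <;> cases hpa : mem i (Γ.placeMask a) <;> cases hpb : mem i (Γ.placeMask b) <;> simp_all

/-! ### Every face has four distinct CM-type corners, none conjugate to another -/

/-- Masks differing in one bit are different. -/
theorem ne_of_mem_ne {X Y : ℕ} (i : Fin n) (h : mem i X ≠ mem i Y) : X ≠ Y :=
  fun e => h (by rw [e])

/-- The two members of a place `placeMask a` are `a` and `c a`. -/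
theorem mem_placeMask_self (a : Fin n) : mem a (Γ.placeMask a) = true := by
  simp [Γ.mem_placeMask]

/-- Flipping a CM type at a place gives a CM type. -/
theorem isCMType_flipAt_placeMask (hΓ : Γ.isCMGaloisType = true) {T : ℕ} (hT : Γ.isCMType T = true) (a : Fin n) :
    Γ.isCMType (flipAt (Γ.placeMask a) T) = true := by
  rw [Γ.isCMType_iff]
  refine ⟨flipAt_lt (Γ.placeMask_lt a) (Γ.lt_of_isCMType hT), fun i => ?_⟩
  rw [mem_flipAt, mem_flipAt, Γ.mem_conj_of_isCMType hT, Γ.mem_conj_placeMask hΓ]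
  cases mem i T <;> cases mem i (Γ.placeMask a) <;> rfl

/-- The conjugate of a CM type is a CM type. -/
theorem isCMType_bar (hΓ : Γ.isCMGaloisType = true) {T : ℕ} (hT : Γ.isCMType T = true) :
    Γ.isCMType (Γ.bar T) = true := by
  rw [Γ.isCMType_iff]
  refine ⟨imageMask_lt _ _, fun i => ?_⟩
  rw [Γ.mem_bar hΓ, Γ.mem_bar hΓ, (IsGroupTable.conj_mul_conj_mul hΓ), Γ.mem_conj_of_isCMType hT, Bool.not_not]

/-- A point of `G` outside two given places (`n ≥ 5`). -/
theorem exists_notMem_two_places (hn : 5 ≤ n) (a b : Fin n) :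
    ∃ i : Fin n, mem i (Γ.placeMask a) = false ∧ mem i (Γ.placeMask b) = false := by
  have hcard : ({a, Γ.mul Γ.conj a, b, Γ.mul Γ.conj b} : Finset (Fin n)).card <
      (Finset.univ : Finset (Fin n)).card := by
    rw [Finset.card_univ, Fintype.card_fin]
    exact lt_of_le_of_lt Finset.card_le_four (by omega)
  obtain ⟨i, -, hi⟩ := Finset.exists_mem_notMem_of_card_lt_card hcard
  simp only [Finset.mem_insert, Finset.mem_singleton, not_or] at hi
  obtain ⟨h1, h2, h3, h4⟩ := hi
  refine ⟨i, ?_, ?_⟩ <;> simp [Γ.mem_placeMask, h1, h2, h3, h4]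

/-- A point of `G` outside a given place (`n ≥ 3`). -/
theorem exists_notMem_place (hn : 3 ≤ n) (a : Fin n) : ∃ i : Fin n, mem i (Γ.placeMask a) = false := by
  have hcard : ({a, Γ.mul Γ.conj a} : Finset (Fin n)).card < (Finset.univ : Finset (Fin n)).card := by
    rw [Finset.card_univ, Fintype.card_fin]
    exact lt_of_le_of_lt Finset.card_le_two (by omega)
  obtain ⟨i, -, hi⟩ := Finset.exists_mem_notMem_of_card_lt_card hcard
  simp only [Finset.mem_insert, Finset.mem_singleton, not_or] at hi
  obtain ⟨h1, h2⟩ := hi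
  exact ⟨i, by simp [Γ.mem_placeMask, h1, h2]⟩

/-- A member of one of two distinct places is not in the other. -/
theorem not_mem_of_mem_of_ne (hΓ : Γ.isCMGaloisType = true) {a b : Fin n} (hab : Γ.placeMask a ≠ Γ.placeMask b)
    {i : Fin n} (ha : mem i (Γ.placeMask a) = true) : mem i (Γ.placeMask b) = false := by
  cases h : mem i (Γ.placeMask b)
  · rfl
  · exact (Γ.not_mem_both_places hΓ hab ha h).elim

/-- The bits of the conjugate of a flip at a place. -/
theorem mem_bar_flipAt_placeMask (hΓ : Γ.isCMGaloisType = true) (a : Fin n) (X : ℕ) (i : Fin n) :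
    mem i (Γ.bar (flipAt (Γ.placeMask a) X)) = (mem i (Γ.bar X) ^^ mem i (Γ.placeMask a)) := by
  rw [Γ.mem_bar hΓ, mem_flipAt, Γ.mem_conj_placeMask hΓ, Γ.mem_bar hΓ]

/-- **Every face has four pairwise distinct CM-type corners** (`n ≥ 3`): each corner is a CM type, and any two corners differ at one explicit bit (a point outside a place, or the point `a` itself). -/
theorem cornersWF_of_mem_faces (hΓ : Γ.isCMGaloisType = true) (hn : 3 ≤ n) {f : ℕ × ℕ × ℕ} (hf : f ∈ Γ.faces) :
    Γ.cornersWF f = true := by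
  obtain ⟨T, p, q⟩ := f
  rw [Γ.mem_faces] at hf
  obtain ⟨hT, hp, hq, hqp⟩ := hf
  rw [Γ.mem_cmTypes] at hT
  obtain ⟨a, rfl⟩ := (Γ.mem_places p).1 hp
  obtain ⟨b, rfl⟩ := (Γ.mem_places q).1 hq
  obtain ⟨w, hw⟩ := Γ.exists_notMem_place hn a
  obtain ⟨w', hw'⟩ := Γ.exists_notMem_place hn b
  have hab : Γ.placeMask a ≠ Γ.placeMask b := Ne.symm hqp
  have haq : mem a (Γ.placeMask b) = false := Γ.not_mem_of_mem_of_ne hΓ hab (Γ.mem_placeMask_self a)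
  have hbp : mem b (Γ.placeMask a) = false :=
    Γ.not_mem_of_mem_of_ne hΓ (Ne.symm hab) (Γ.mem_placeMask_self b)
  -- the four corners are CM types
  have hc1 : Γ.isCMType T = true := hT
  have hc2 : Γ.isCMType (flipAt (Γ.placeMask a) (Γ.bar T)) = true :=
    Γ.isCMType_flipAt_placeMask hΓ (Γ.isCMType_bar hΓ hT) a
  have hc3 : Γ.isCMType (flipAt (Γ.placeMask b) (Γ.bar T)) = true :=
    Γ.isCMType_flipAt_placeMask hΓ (Γ.isCMType_bar hΓ hT) b
  have hc4 : Γ.isCMType (flipAt (Γ.placeMask b) (flipAt (Γ.placeMask a) T)) = true :=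
    Γ.isCMType_flipAt_placeMask hΓ (Γ.isCMType_flipAt_placeMask hΓ hT a) b
  -- the four corners are pairwise distinct (bit witnesses)
  have h12 : T ≠ flipAt (Γ.placeMask a) (Γ.bar T) := ne_of_mem_ne w (by
    rw [mem_flipAt, Γ.mem_bar_of_isCMType hΓ hT, hw]; cases mem w T <;> decide)
  have h13 : T ≠ flipAt (Γ.placeMask b) (Γ.bar T) := ne_of_mem_ne w' (by
    rw [mem_flipAt, Γ.mem_bar_of_isCMType hΓ hT, hw']; cases mem w' T <;> decide)
  have h14 : T ≠ flipAt (Γ.placeMask b) (flipAt (Γ.placeMask a) T) := ne_of_mem_ne a (by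
    rw [mem_flipAt, mem_flipAt, Γ.mem_placeMask_self, haq]; cases mem a T <;> decide)
  have h23 : flipAt (Γ.placeMask a) (Γ.bar T) ≠ flipAt (Γ.placeMask b) (Γ.bar T) := ne_of_mem_ne a (by
    rw [mem_flipAt, mem_flipAt, Γ.mem_placeMask_self, haq]; cases mem a (Γ.bar T) <;> decide)
  have h24 : flipAt (Γ.placeMask a) (Γ.bar T) ≠ flipAt (Γ.placeMask b) (flipAt (Γ.placeMask a) T) :=
    ne_of_mem_ne w' (by
      rw [mem_flipAt, mem_flipAt, mem_flipAt, Γ.mem_bar_of_isCMType hΓ hT, hw']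
      cases mem w' T <;> cases mem w' (Γ.placeMask a) <;> decide)
  have h34 : flipAt (Γ.placeMask b) (Γ.bar T) ≠ flipAt (Γ.placeMask b) (flipAt (Γ.placeMask a) T) :=
    ne_of_mem_ne w (by
      rw [mem_flipAt, mem_flipAt, mem_flipAt, Γ.mem_bar_of_isCMType hΓ hT, hw]
      cases mem w T <;> cases mem w (Γ.placeMask b) <;> decide)
  simp only [cornersWF, corners, Bool.and_eq_true, List.all_cons, List.all_nil, hc1, hc2, hc3, hc4,
    Bool.and_self, true_and]
  simp [List.eraseDups_cons, Ne.symm h12, Ne.symm h13, Ne.symm h14, Ne.symm h23, Ne.symm h24, Ne.symm h34]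

/-- **No two corners of a face are complex-conjugate types** (`n ≥ 5`): the 16 pairs (corner, conjugate of a corner) are separated one bit each, using a point outside both places (which exists since `|p ∪ q| = 4 < n`). -/
theorem noConjugateCorners_of_mem_faces (hΓ : Γ.isCMGaloisType = true) (hn : 5 ≤ n) {f : ℕ × ℕ × ℕ}
    (hf : f ∈ Γ.faces) : Γ.noConjugateCorners f = true := by
  obtain ⟨T, p, q⟩ := f
  rw [Γ.mem_faces] at hf
  obtain ⟨hT, hp, hq, hqp⟩ := hf
  rw [Γ.mem_cmTypes] at hT
  obtain ⟨a, rfl⟩ := (Γ.mem_places p).1 hp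
  obtain ⟨b, rfl⟩ := (Γ.mem_places q).1 hq
  obtain ⟨w, hwa, hwb⟩ := Γ.exists_notMem_two_places hn a b
  have hab : Γ.placeMask a ≠ Γ.placeMask b := Ne.symm hqp
  have haq : mem a (Γ.placeMask b) = false := Γ.not_mem_of_mem_of_ne hΓ hab (Γ.mem_placeMask_self a)
  have hbp : mem b (Γ.placeMask a) = false :=
    Γ.not_mem_of_mem_of_ne hΓ (Ne.symm hab) (Γ.mem_placeMask_self b)
  have haa := Γ.mem_placeMask_self a
  have hbb := Γ.mem_placeMask_self b
  -- bit lemmas for the four corners and their conjugates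
  have hbT := Γ.mem_bar_of_isCMType hΓ hT
  have hbb' : ∀ i, mem i (Γ.bar (Γ.bar T)) = mem i T := fun i => by
    rw [Γ.mem_bar hΓ, Γ.mem_bar hΓ, (IsGroupTable.conj_mul_conj_mul hΓ)]
  simp only [noConjugateCorners, corners, List.all_cons, List.all_nil, Bool.and_true, Bool.and_eq_true,
    Bool.not_eq_eq_eq_not, Bool.not_true, List.contains_eq_mem, decide_eq_false_iff_not,
    List.mem_cons, List.not_mem_nil, or_false, not_or]
  refine ⟨⟨?_, ?_, ?_, ?_⟩, ⟨?_, ?_, ?_, ?_⟩, ⟨?_, ?_, ?_, ?_⟩, ⟨?_, ?_, ?_, ?_⟩⟩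
  -- bar c1 vs c1..c4
  · exact ne_of_mem_ne w (by rw [hbT]; cases mem w T <;> decide)
  · exact ne_of_mem_ne a (by rw [hbT, mem_flipAt, hbT, haa]; cases mem a T <;> decide)
  · exact ne_of_mem_ne b (by rw [hbT, mem_flipAt, hbT, hbb]; cases mem b T <;> decide)
  · exact ne_of_mem_ne w (by rw [hbT, mem_flipAt, mem_flipAt, hwa, hwb]; cases mem w T <;> decide)
  -- bar c2 vs c1..c4
  · exact ne_of_mem_ne a (by rw [Γ.mem_bar_flipAt_placeMask hΓ, hbb', haa]; cases mem a T <;> decide)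
  · exact ne_of_mem_ne w (by
      rw [Γ.mem_bar_flipAt_placeMask hΓ, hbb', mem_flipAt, hbT, hwa]; cases mem w T <;> decide)
  · exact ne_of_mem_ne w (by
      rw [Γ.mem_bar_flipAt_placeMask hΓ, hbb', mem_flipAt, hbT, hwa, hwb]; cases mem w T <;> decide)
  · exact ne_of_mem_ne b (by
      rw [Γ.mem_bar_flipAt_placeMask hΓ, hbb', mem_flipAt, mem_flipAt, hbp, hbb]; cases mem b T <;> decide)
  -- bar c3 vs c1..c4
  · exact ne_of_mem_ne b (by rw [Γ.mem_bar_flipAt_placeMask hΓ, hbb', hbb]; cases mem b T <;> decide)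
  · exact ne_of_mem_ne w (by
      rw [Γ.mem_bar_flipAt_placeMask hΓ, hbb', mem_flipAt, hbT, hwa, hwb]; cases mem w T <;> decide)
  · exact ne_of_mem_ne w (by
      rw [Γ.mem_bar_flipAt_placeMask hΓ, hbb', mem_flipAt, hbT, hwb]; cases mem w T <;> decide)
  · exact ne_of_mem_ne a (by
      rw [Γ.mem_bar_flipAt_placeMask hΓ, hbb', mem_flipAt, mem_flipAt, haq, haa]; cases mem a T <;> decide)
  -- bar c4 vs c1..c4
  · exact ne_of_mem_ne w (by
      rw [Γ.mem_bar_flipAt_placeMask hΓ, Γ.mem_bar_flipAt_placeMask hΓ, hbT, hwa, hwb]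
      cases mem w T <;> decide)
  · exact ne_of_mem_ne b (by
      rw [Γ.mem_bar_flipAt_placeMask hΓ, Γ.mem_bar_flipAt_placeMask hΓ, hbT, mem_flipAt, hbT, hbp, hbb]
      cases mem b T <;> decide)
  · exact ne_of_mem_ne a (by
      rw [Γ.mem_bar_flipAt_placeMask hΓ, Γ.mem_bar_flipAt_placeMask hΓ, hbT, mem_flipAt, hbT, haq, haa]
      cases mem a T <;> decide)
  · exact ne_of_mem_ne w (by
      rw [Γ.mem_bar_flipAt_placeMask hΓ, Γ.mem_bar_flipAt_placeMask hΓ, hbT, mem_flipAt, mem_flipAt, hwa, hwb]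
      cases mem w T <;> decide)

/-- Every face of a Galois CM type of order `≥ 5` is well formed: `SumTwo`, four distinct CM-type
corners, no two of them conjugate. -/
theorem faces_all_wf (hΓ : Γ.isCMGaloisType = true) (hn : 5 ≤ n) :
    Γ.faces.all (fun f => Γ.sumTwo f && Γ.cornersWF f && Γ.noConjugateCorners f) = true := by
  rw [List.all_eq_true]
  intro f hf
  rw [Bool.and_eq_true, Bool.and_eq_true]
  exact ⟨⟨Γ.sumTwo_of_mem_faces hΓ hf, Γ.cornersWF_of_mem_faces hΓ (by omega) hf⟩,
    Γ.noConjugateCorners_of_mem_faces hΓ hn hf⟩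

end CMGaloisType

end Summit.Ventures.HodgeRepro.FaceCensus
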